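import Literature.NumberTheory.LFunctions.SelbergClassConvexityBound
import HarnessLib

/-!
# The Selberg class: the convexity bound UNIFORMLY over a family (explicit conductor dependence)

`Literature.NumberTheory.LFunctions.SelbergDatum.exists_norm_pow_mul_toFun_le`
(`SelbergClassConvexityBound.lean`) proves polynomial growth of `(s - 1)^m F(s)` in vertical strips
for ONE Selberg datum, with constants hidden under `∃`. For families of `L`-functions (all twists,
all symmetric powers of all elliptic curves, …) one needs the same bound with constants depending
only on the *shape* of the functional equation and on `Q` only polynomially — the classical
**convexity bound in the conductor aspect** (Iwaniec–Kowalski, *Analytic Number Theory*, §5.2,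
(5.20)–(5.21); Conrey–Ghosh 1993, §2). This file re-runs the tree's proof keeping the constants
explicit:

* `SelbergDatum.norm_toFun_left_line_le_uniform` — on the far-left line `re s = 1 - κ`,
  `‖F(1 - κ + it)‖ ≤ Q^{2κ-1} · (120π² β₀^{e₀})^n · (1 + |t|)^{n e₀} · A₀`, where `n ≥ numGamma`,
  `λⱼ ≤ Λ₀`, `‖μⱼ‖ ≤ M₀`, `A₀` bounds `F` on `re s ≥ 3/2`, `β₀ = 3Λ₀κ + 3M₀ + 4`,
  `e₀ = Λ₀(2κ - 1) + 2` (functional equation + the uniform vertical Gamma-ratio bound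
  `Literature.Analysis.SpecialFunctions.norm_Gamma_mul_norm_inv_Gamma_le`).
* `SelbergDatum.exists_uniform_norm_pow_mul_toFun_le` — **uniform convexity bound**: for a shape
  class (`numGamma ≤ n`, `polarOrder ≤ m₀`, `λ₀ ≤ λⱼ ≤ Λ₀`, `‖μⱼ‖ ≤ M₀`), a bound `A₀` for `F` on
  `re s ≥ 3/2` and a strip `σ₁ ≤ re s ≤ σ₂`, there are `C, A` (depending on these data only) with
  `‖(s - 1)^m F(s)‖ ≤ C · max(1, Q)^A · (1 + |im s|)^A` for EVERY datum of the class and every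
  `s ≠ 1` in the strip (Rademacher's Phragmén–Lindelöf theorem with explicit constants,
  `Literature.Analysis.Complex.rademacher_phragmenLindelof_of_finiteOrder`; the finite-order
  axiom (ii) enters only qualitatively).

No new definitions, no named facts: proofs only.

## References

* H. Iwaniec, E. Kowalski, *Analytic Number Theory*, AMS Colloquium Publ. 53 (2004), §5.2,
  (5.20)–(5.21) (convexity bound in terms of the analytic conductor). [IwaniecKowalski2004]
* J. B. Conrey, A. Ghosh, *On the Selberg class of Dirichlet series: small degrees*, Duke Math. J.
  72 (1993), 673–693, §2. [ConreyGhosh1993]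
* H. Rademacher, *On the Phragmén–Lindelöf theorem and some applications*, Math. Z. 72 (1959),
  Theorem 2. [Rademacher1959]
-/

noncomputable section

open Complex Filter Topology Set Asymptotics Metric
open scoped ComplexConjugate

namespace Literature.NumberTheory.LFunctions

namespace SelbergDatum

open Literature.Analysis.SpecialFunctions Literature.Analysis.Complex

variable (D : SelbergDatum)

set_option maxHeartbeats 1000000 in
/-- **Polynomial growth of `F` on a far-left vertical line, with explicit constants.** If
`numGamma ≤ n`, `λⱼ ≤ Λ₀`, `‖μⱼ‖ ≤ M₀`, `κ ≥ 2` with `λⱼ(κ - 1) ≥ 1 + M₀` for all `j`, and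
`‖F(s)‖ ≤ A₀` for `re s ≥ 3/2`, then for all real `t`,
`‖F(1 - κ + it)‖ ≤ Q^{2κ-1} (120π² β₀^{e₀})^n (1 + |t|)^{n e₀} A₀` with `β₀ = 3Λ₀κ + 3M₀ + 4`,
`e₀ = Λ₀(2κ - 1) + 2`: the functional equation in the pole-free form
`SelbergDatum.norm_toFun_eq_of_re_lt_one` and the uniform vertical Gamma-ratio bound
`norm_Gamma_mul_norm_inv_Gamma_le`. The dependence on the datum is only through `Q` and the shape
bounds (convexity bound in the conductor aspect, Iwaniec–Kowalski §5.2).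
[cite: IwaniecKowalski2004, §5.2 (5.20)] -/
theorem norm_toFun_left_line_le_uniform {n : ℕ} {Λ₀ M₀ A₀ κ : ℝ} (hn : D.numGamma ≤ n)
    (hΛ : ∀ j, D.lam j ≤ Λ₀) (hΛ₀ : 0 ≤ Λ₀) (hM : ∀ j, ‖D.mu j‖ ≤ M₀) (hM₀ : 0 ≤ M₀)
    (hκ2 : 2 ≤ κ) (hkj : ∀ j, 1 + M₀ ≤ D.lam j * (κ - 1))
    (hA₀ : ∀ s : ℂ, 3 / 2 ≤ s.re → ‖D.toFun s‖ ≤ A₀) (t : ℝ) :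
    ‖D.toFun (((1 - κ : ℝ) : ℂ) + t * I)‖ ≤
      D.Q ^ (2 * κ - 1) *
        ((120 * Real.pi ^ 2) * (3 * Λ₀ * κ + 3 * M₀ + 4) ^ (Λ₀ * (2 * κ - 1) + 2)) ^ n *
        (1 + |t|) ^ ((n : ℝ) * (Λ₀ * (2 * κ - 1) + 2)) * A₀ := by
  -- exponent and constants
  set e₀ : ℝ := Λ₀ * (2 * κ - 1) + 2 with he₀
  have he₀0 : 0 ≤ e₀ := by rw [he₀]; nlinarith
  set β₀ : ℝ := 3 * Λ₀ * κ + 3 * M₀ + 4 with hβ₀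
  have hΛκ0 : 0 ≤ Λ₀ * κ := mul_nonneg hΛ₀ (by linarith)
  have hβ₀1 : 1 ≤ β₀ := by rw [hβ₀]; nlinarith
  have hβ₀0 : 0 < β₀ := by linarith
  have hQ0 := D.Q_pos
  set σ : ℝ := 1 - κ with hσ
  set s : ℂ := (σ : ℂ) + t * I with hs
  have hsre : s.re = σ := by simp [hs]
  have hsim : s.im = t := by simp [hs]
  have hs0 : s ≠ 0 := fun h ↦ by
    have := congrArg Complex.re h; rw [hsre, Complex.zero_re, hσ] at this; linarith
  have hs1 : s.re < 1 := by rw [hsre, hσ]; linarith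
  rw [D.norm_toFun_eq_of_re_lt_one s hs0 hs1]
  -- (a) the power of `Q`
  have hQ : D.Q ^ (1 - 2 * s.re) = D.Q ^ (2 * κ - 1) := by rw [hsre, hσ]; ring_nf
  -- (b) `‖F(1 - conj s)‖ ≤ A₀`
  have hF1 : ‖D.toFun (1 - conj s)‖ ≤ A₀ := hA₀ _ (by simp [hsre, hσ]; linarith)
  -- (c) the Gamma ratios: `β = β₀ (1 + |t|)` dominates everything
  set β : ℝ := β₀ * (1 + |t|) with hβ
  have ht0 : 0 ≤ |t| := abs_nonneg t
  have hβ1 : 1 ≤ β := by rw [hβ]; nlinarith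
  have hβ0 : 0 < β := by linarith
  have hβexp : β = β₀ + β₀ * |t| := by rw [hβ]; ring
  have hΛβ₀ : Λ₀ ≤ β₀ := by rw [hβ₀]; nlinarith
  have hΛt : Λ₀ * |t| ≤ β₀ * |t| := mul_le_mul_of_nonneg_right hΛβ₀ ht0
  have hratio : ∀ j, ‖Gamma (D.lam j * (1 - s) + conj (D.mu j))‖ *
      ‖(Gamma (D.lam j * s + D.mu j))⁻¹‖ ≤ 120 * Real.pi ^ 2 * β ^ e₀ := by
    intro j
    have hl := D.lam_pos j
    have hlΛ := hΛ j
    have hμre := D.mu_re_nonneg j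
    obtain ⟨X, hX⟩ : ∃ X : ℝ, D.lam j * κ + (D.mu j).re = X := ⟨_, rfl⟩
    obtain ⟨Y, hY⟩ : ∃ Y : ℝ, (D.mu j).re - D.lam j * (κ - 1) = Y := ⟨_, rfl⟩
    obtain ⟨u, hu⟩ : ∃ u : ℝ, D.lam j * t + (D.mu j).im = u := ⟨_, rfl⟩
    have hnum : (D.lam j : ℂ) * (1 - s) + conj (D.mu j) = conj ((X : ℂ) + u * I) := by
      apply Complex.ext
      · rw [re_lam_mul_add, Complex.sub_re, Complex.one_re, hsre, Complex.conj_re]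
        simp only [Complex.conj_re, Complex.add_re, Complex.ofReal_re, Complex.mul_re, Complex.I_re,
          Complex.ofReal_im, Complex.I_im, mul_zero, mul_one, sub_self, add_zero]
        rw [← hX, hσ]; ring
      · rw [im_lam_mul_add, Complex.sub_im, Complex.one_im, hsim, Complex.conj_im]
        simp only [Complex.conj_im, Complex.add_im, Complex.ofReal_im, Complex.mul_im, Complex.I_re,
          Complex.ofReal_re, Complex.I_im, mul_zero, mul_one, zero_add, add_zero]
        rw [← hu]; ring
    have hden : (D.lam j : ℂ) * s + D.mu j = (Y : ℂ) + u * I := by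
      apply Complex.ext
      · rw [re_lam_mul_add, hsre]
        simp only [Complex.add_re, Complex.ofReal_re, Complex.mul_re, Complex.I_re, Complex.ofReal_im,
          Complex.I_im, mul_zero, mul_one, sub_self, add_zero]
        rw [← hY, hσ]; ring
      · rw [im_lam_mul_add, hsim]
        simp only [Complex.add_im, Complex.ofReal_im, Complex.mul_im, Complex.I_re, Complex.ofReal_re,
          Complex.I_im, mul_zero, mul_one, zero_add, add_zero]
        rw [← hu]
    have hμ1 : |(D.mu j).im| ≤ ‖D.mu j‖ := Complex.abs_im_le_norm _
    have hμ2 : |(D.mu j).re| ≤ ‖D.mu j‖ := Complex.abs_re_le_norm _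
    have hμ3 := hM j
    have hX1 : 1 ≤ X := by
      rw [← hX]; nlinarith [hkj j]
    have hY1 : Y ≤ 1 / 2 := by
      rw [← hY]; linarith [hkj j, le_abs_self (D.mu j).re]
    rw [hnum, Complex.Gamma_conj, Complex.norm_conj, hden]
    refine (norm_Gamma_mul_norm_inv_Gamma_le hX1 hY1 u).trans ?_
    have hu1 : |u| ≤ Λ₀ * |t| + M₀ := by
      rw [← hu]
      refine (abs_add_le _ _).trans ?_
      rw [abs_mul, abs_of_pos hl]
      have : D.lam j * |t| ≤ Λ₀ * |t| := mul_le_mul_of_nonneg_right hlΛ ht0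
      linarith
    have hlk : D.lam j * κ ≤ Λ₀ * κ := mul_le_mul_of_nonneg_right hlΛ (by linarith)
    have hb1 : 1 + |u| ≤ β := by rw [hβexp, hβ₀]; nlinarith
    have hXle : X ≤ Λ₀ * κ + M₀ := by
      rw [← hX]; linarith [le_abs_self (D.mu j).re]
    have hYle : |Y| ≤ Λ₀ * κ + M₀ := by
      rw [← hY, abs_le]; constructor
      · nlinarith [neg_abs_le (D.mu j).re]
      · linarith [le_abs_self (D.mu j).re]
    have hb2 : X + |Y| + 3 + |u| ≤ β := by rw [hβexp, hβ₀]; nlinarith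
    have hexp : X - Y + 1 / 2 = D.lam j * (2 * κ - 1) + 1 / 2 := by rw [← hX, ← hY]; ring
    rw [hexp]
    have he1 : D.lam j * (2 * κ - 1) + 1 / 2 ≤ Λ₀ * (2 * κ - 1) + 1 / 2 := by
      have : D.lam j * (2 * κ - 1) ≤ Λ₀ * (2 * κ - 1) :=
        mul_le_mul_of_nonneg_right hlΛ (by linarith)
      linarith
    have he2 : 0 ≤ D.lam j * (2 * κ - 1) + 1 / 2 := by nlinarith
    have hu0 : 0 ≤ 1 + |u| := by linarith [abs_nonneg u]
    have hv0 : 0 ≤ X + |Y| + 3 + |u| := by linarith [abs_nonneg Y, abs_nonneg u]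
    have h1 : (1 + |u|) ^ (3 / 2 : ℝ) ≤ β ^ (3 / 2 : ℝ) := Real.rpow_le_rpow hu0 hb1 (by norm_num)
    have h2 : (X + |Y| + 3 + |u|) ^ (D.lam j * (2 * κ - 1) + 1 / 2) ≤
        β ^ (Λ₀ * (2 * κ - 1) + 1 / 2) :=
      (Real.rpow_le_rpow hv0 hb2 he2).trans (Real.rpow_le_rpow_of_exponent_le hβ1 he1)
    have hc0 : (0 : ℝ) ≤ 120 * Real.pi ^ 2 := by positivity
    have h3 : 120 * Real.pi ^ 2 * (1 + |u|) ^ (3 / 2 : ℝ) ≤ 120 * Real.pi ^ 2 * β ^ (3 / 2 : ℝ) :=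
      mul_le_mul_of_nonneg_left h1 hc0
    have h4 : (0 : ℝ) ≤ 120 * Real.pi ^ 2 * β ^ (3 / 2 : ℝ) := mul_nonneg hc0 (Real.rpow_nonneg hβ0.le _)
    have h5 := mul_le_mul h3 h2 (Real.rpow_nonneg hv0 _) h4
    refine h5.trans_eq ?_
    rw [mul_assoc, ← Real.rpow_add hβ0]
    congr 1; rw [he₀]; ring_nf
  -- the product of the ratios
  have hbase1 : (1 : ℝ) ≤ 120 * Real.pi ^ 2 * β ^ e₀ := by
    have hπ : (1 : ℝ) ≤ 120 * Real.pi ^ 2 := by nlinarith [Real.pi_gt_three]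
    have hb : (1 : ℝ) ≤ β ^ e₀ := Real.one_le_rpow hβ1 he₀0
    nlinarith
  have hprod : (∏ j, (‖Gamma (D.lam j * (1 - s) + conj (D.mu j))‖ *
      ‖(Gamma (D.lam j * s + D.mu j))⁻¹‖)) ≤ (120 * Real.pi ^ 2 * β ^ e₀) ^ n := by
    calc (∏ j, (‖Gamma (D.lam j * (1 - s) + conj (D.mu j))‖ * ‖(Gamma (D.lam j * s + D.mu j))⁻¹‖))
        ≤ ∏ _j : Fin D.numGamma, (120 * Real.pi ^ 2 * β ^ e₀) :=
          Finset.prod_le_prod (fun j _ ↦ by positivity) (fun j _ ↦ hratio j)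
      _ = (120 * Real.pi ^ 2 * β ^ e₀) ^ D.numGamma := by
          rw [Finset.prod_const, Finset.card_univ, Fintype.card_fin]
      _ ≤ (120 * Real.pi ^ 2 * β ^ e₀) ^ n := pow_le_pow_right₀ hbase1 hn
  -- `(120π² β^{e₀})^n = (120π² β₀^{e₀})^n (1 + |t|)^{n e₀}`
  have hsplit : (120 * Real.pi ^ 2 * β ^ e₀) ^ n =
      (120 * Real.pi ^ 2 * β₀ ^ e₀) ^ n * (1 + |t|) ^ ((n : ℝ) * e₀) := by
    have ht1 : (0 : ℝ) ≤ 1 + |t| := by linarith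
    rw [hβ, Real.mul_rpow hβ₀0.le ht1, ← mul_assoc, mul_pow, mul_comm (n : ℝ) e₀,
      Real.rpow_mul ht1, Real.rpow_natCast]
  rw [hQ]
  have hP0 : 0 ≤ ∏ j, (‖Gamma (D.lam j * (1 - s) + conj (D.mu j))‖ * ‖(Gamma (D.lam j * s + D.mu j))⁻¹‖) :=
    Finset.prod_nonneg fun j _ ↦ by positivity
  have hQ0' : 0 ≤ D.Q ^ (2 * κ - 1) := Real.rpow_nonneg D.Q_pos.le _
  have step1 : D.Q ^ (2 * κ - 1) *
      (∏ j, (‖Gamma (D.lam j * (1 - s) + conj (D.mu j))‖ * ‖(Gamma (D.lam j * s + D.mu j))⁻¹‖)) *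
      ‖D.toFun (1 - conj s)‖ ≤
      D.Q ^ (2 * κ - 1) * ((120 * Real.pi ^ 2 * β ^ e₀) ^ n) * A₀ :=
    mul_le_mul (mul_le_mul_of_nonneg_left hprod hQ0') hF1 (norm_nonneg _)
      (mul_nonneg hQ0' (by positivity))
  refine step1.trans_eq ?_
  rw [hsplit]; ring

set_option maxHeartbeats 1600000 in
/-- **The convexity bound, uniformly over a family of Selberg data (conductor aspect).** Fix a
shape class — at most `n` gamma factors, polar order at most `m₀`, `λ₀ ≤ λⱼ ≤ Λ₀` (`λ₀ > 0`),
`‖μⱼ‖ ≤ M₀` — a bound `A₀` for `F` on `re s ≥ 3/2`, and a strip `σ₁ ≤ re s ≤ σ₂`. Then there are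
constants `C > 0`, `A ≥ 0`, depending only on `(n, m₀, λ₀, Λ₀, M₀, A₀, σ₁, σ₂)`, such that for
EVERY Selberg datum of the class and every `s ≠ 1` in the strip,
`‖(s - 1)^m F(s)‖ ≤ C · max(1, Q)^A · (1 + |im s|)^A`.
Proof: Rademacher's Phragmén–Lindelöf theorem with explicit constants
(`rademacher_phragmenLindelof_of_finiteOrder`) for the entire function `(s - 1)^m F(s)` on the
strip `[1 - κ, κ]`, `κ = 3 + (1 + M₀)/λ₀ + |σ₁| + |σ₂|`, bounded on the right edge by `A₀` and on the
left edge by `norm_toFun_left_line_le_uniform`; the finite-order axiom (ii) is used only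
qualitatively, so its constants do not enter. This is the convexity bound of Iwaniec–Kowalski,
§5.2, (5.20)–(5.21), in the weak form (any polynomial in `Q` and `|t|`) that suffices for
polynomial bounds in the conductor. [cite: IwaniecKowalski2004, §5.2 (5.20)–(5.21)] -/
theorem exists_uniform_norm_pow_mul_toFun_le (n m₀ : ℕ) {lam₀ : ℝ} (hlam₀ : 0 < lam₀)
    (Λ₀ M₀ A₀ σ₁ σ₂ : ℝ) :
    ∃ C A : ℝ, 0 < C ∧ 0 ≤ A ∧ ∀ D : SelbergDatum, D.numGamma ≤ n → D.polarOrder ≤ m₀ →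
      (∀ j, lam₀ ≤ D.lam j) → (∀ j, D.lam j ≤ Λ₀) → (∀ j, ‖D.mu j‖ ≤ M₀) →
      (∀ s : ℂ, 3 / 2 ≤ s.re → ‖D.toFun s‖ ≤ A₀) →
      ∀ s : ℂ, σ₁ ≤ s.re → s.re ≤ σ₂ → s ≠ 1 →
        ‖(s - 1) ^ D.polarOrder * D.toFun s‖ ≤ C * max 1 D.Q ^ A * (1 + |s.im|) ^ A := by
  -- normalised shape bounds
  set M : ℝ := max M₀ 0 with hMdef
  have hM0 : 0 ≤ M := le_max_right _ _
  set Λ : ℝ := max Λ₀ 1 with hΛdef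
  have hΛ1 : 1 ≤ Λ := le_max_right _ _
  have hΛ0 : 0 ≤ Λ := by linarith
  set Ab : ℝ := max A₀ 1 with hAbdef
  have hAb1 : 1 ≤ Ab := le_max_right _ _
  have hAb0 : 0 < Ab := by linarith
  -- the strip `[1 - κ, κ]`
  set κ : ℝ := 3 + (1 + M) / lam₀ + |σ₁| + |σ₂| with hκdef
  have hdiv0 : 0 ≤ (1 + M) / lam₀ := div_nonneg (by linarith) hlam₀.le
  have hκ3 : 3 ≤ κ := by rw [hκdef]; linarith [abs_nonneg σ₁, abs_nonneg σ₂]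
  have hκ2 : 2 ≤ κ := by linarith
  have hσ₁ : 1 - κ ≤ σ₁ := by rw [hκdef]; linarith [neg_abs_le σ₁, abs_nonneg σ₂]
  have hσ₂ : σ₂ ≤ κ := by rw [hκdef]; linarith [le_abs_self σ₂, abs_nonneg σ₁]
  have hab : 1 - κ < κ := by linarith
  -- constants
  set e₀ : ℝ := Λ * (2 * κ - 1) + 2 with he₀
  have he₀0 : 0 ≤ e₀ := by rw [he₀]; nlinarith
  set β₀ : ℝ := 3 * Λ * κ + 3 * M + 4 with hβ₀
  have hβ₀1 : 1 ≤ β₀ := by rw [hβ₀]; nlinarith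
  set A₁ : ℝ := (n : ℝ) * e₀ with hA₁
  have hA₁0 : 0 ≤ A₁ := by rw [hA₁]; positivity
  set C₁ : ℝ := ((120 * Real.pi ^ 2) * β₀ ^ e₀) ^ n * Ab with hC₁
  have hC₁0 : 0 < C₁ := by rw [hC₁]; positivity
  set L : ℝ := C₁ * 2 ^ A₁ * (κ + 2) ^ m₀ with hL
  have hL0 : 0 < L := by rw [hL]; positivity
  set R : ℝ := Ab * (κ + 2) ^ m₀ with hR
  have hR0 : 0 < R := by rw [hR]; positivity
  set α : ℝ := (m₀ : ℝ) + A₁ with hα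
  have hα0 : 0 ≤ α := by rw [hα]; positivity
  set M'' : ℝ := max L R with hM''
  have hM''0 : 0 < M'' := lt_max_of_lt_left hL0
  set Aexp : ℝ := max α (2 * κ - 1) with hAexp
  have hAexp0 : 0 ≤ Aexp := le_max_of_le_left hα0
  refine ⟨M'' * (2 * κ) ^ α, Aexp, by positivity, hAexp0, ?_⟩
  intro D hn hm hlam hΛ' hM' hA₀' s hs₁ hs₂ hs1
  -- the shape hypotheses in normalised form
  have hΛD : ∀ j, D.lam j ≤ Λ := fun j ↦ (hΛ' j).trans (le_max_left _ _)
  have hMD : ∀ j, ‖D.mu j‖ ≤ M := fun j ↦ (hM' j).trans (le_max_left _ _)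
  have hAD : ∀ z : ℂ, 3 / 2 ≤ z.re → ‖D.toFun z‖ ≤ Ab := fun z hz ↦ (hA₀' z hz).trans (le_max_left _ _)
  have hkj : ∀ j, 1 + M ≤ D.lam j * (κ - 1) := by
    intro j
    have hl := hlam j
    have h1 : (1 + M) / lam₀ ≤ κ - 1 := by rw [hκdef]; linarith [abs_nonneg σ₁, abs_nonneg σ₂]
    have h2 : lam₀ * ((1 + M) / lam₀) = 1 + M := mul_div_cancel₀ _ hlam₀.ne'
    have h3 : lam₀ * ((1 + M) / lam₀) ≤ D.lam j * (κ - 1) :=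
      mul_le_mul hl h1 hdiv0 (D.lam_pos j).le
    linarith
  -- the quantity `QQ = max(1, Q)^{2κ - 1} ≥ 1`
  set QQ : ℝ := max 1 D.Q ^ (2 * κ - 1) with hQQ
  have hQ1 : (1 : ℝ) ≤ max 1 D.Q := le_max_left _ _
  have hQQ1 : 1 ≤ QQ := Real.one_le_rpow hQ1 (by linarith)
  have hQQ0 : 0 < QQ := by linarith
  have hQpow : D.Q ^ (2 * κ - 1) ≤ QQ :=
    Real.rpow_le_rpow D.Q_pos.le (le_max_right _ _) (by linarith)
  obtain ⟨G, hG, hGF⟩ := D.differentiable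
  obtain ⟨Af, Bf, hfin⟩ := D.finiteOrder
  -- `‖κ + z‖ ≥ 1` and `|z - 1| ≤ (κ+2) ‖κ + z‖` on the closed strip
  have hQz : ∀ z : ℂ, 1 - κ ≤ z.re → 1 ≤ ‖(κ : ℂ) + z‖ := fun z hz ↦ by
    have : ((κ : ℂ) + z).re = κ + z.re := by simp
    calc (1 : ℝ) ≤ κ + z.re := by linarith
      _ = |((κ : ℂ) + z).re| := by rw [this, abs_of_nonneg (by linarith)]
      _ ≤ ‖(κ : ℂ) + z‖ := Complex.abs_re_le_norm _
  have hz1 : ∀ z : ℂ, 1 - κ ≤ z.re → ‖z - 1‖ ≤ (κ + 2) * ‖(κ : ℂ) + z‖ := fun z hz ↦ by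
    have h1 := hQz z hz
    have hk1 : ‖((κ : ℂ) + 1 : ℂ)‖ = κ + 1 := by
      rw [show ((κ : ℂ) + 1 : ℂ) = ((κ + 1 : ℝ) : ℂ) by push_cast; ring, Complex.norm_real,
        Real.norm_of_nonneg (by linarith)]
    calc ‖z - 1‖ = ‖((κ : ℂ) + z) - ((κ : ℂ) + 1)‖ := by ring_nf
      _ ≤ ‖(κ : ℂ) + z‖ + ‖((κ : ℂ) + 1 : ℂ)‖ := norm_sub_le _ _
      _ = ‖(κ : ℂ) + z‖ + (κ + 1) := by rw [hk1]
      _ ≤ (κ + 2) * ‖(κ : ℂ) + z‖ := by nlinarith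
  -- `‖z - 1‖^m ≤ ((κ+2)‖κ+z‖)^{m₀}` on the closed strip
  have hzpow : ∀ z : ℂ, 1 - κ ≤ z.re →
      ‖z - 1‖ ^ D.polarOrder ≤ ((κ + 2) * ‖(κ : ℂ) + z‖) ^ m₀ := fun z hz ↦ by
    have h1 : 1 ≤ (κ + 2) * ‖(κ : ℂ) + z‖ := by nlinarith [hQz z hz]
    calc ‖z - 1‖ ^ D.polarOrder ≤ ((κ + 2) * ‖(κ : ℂ) + z‖) ^ D.polarOrder :=
          pow_le_pow_left₀ (norm_nonneg _) (hz1 z hz) _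
      _ ≤ ((κ + 2) * ‖(κ : ℂ) + z‖) ^ m₀ := pow_le_pow_right₀ h1 hm
  -- (1) left edge
  have hleft' : ∀ z : ℂ, z.re = 1 - κ → ‖G z‖ ≤ (QQ * L) * ‖(κ : ℂ) + z‖ ^ α := by
    intro z hz
    have hzne : z ≠ 1 := by
      intro h; rw [h, Complex.one_re] at hz; linarith
    have hzeq : z = ((1 - κ : ℝ) : ℂ) + z.im * I := by
      apply Complex.ext <;> simp [hz]
    have hF : ‖D.toFun z‖ ≤ D.Q ^ (2 * κ - 1) * ((120 * Real.pi ^ 2) * β₀ ^ e₀) ^ n *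
        (1 + |z.im|) ^ A₁ * Ab := by
      have := D.norm_toFun_left_line_le_uniform (n := n) (A₀ := Ab) hn hΛD hΛ0 hMD hM0 hκ2 hkj hAD z.im
      rw [← hzeq] at this
      simpa only [hA₁] using this
    have hQ1' := hQz z hz.ge
    have hQ0 : 0 < ‖(κ : ℂ) + z‖ := by linarith
    have ht : 1 + |z.im| ≤ 2 * ‖(κ : ℂ) + z‖ := by
      have : |z.im| ≤ ‖(κ : ℂ) + z‖ := by
        have := Complex.abs_im_le_norm ((κ : ℂ) + z); simpa using this
      linarith
    have ht0 : 0 ≤ 1 + |z.im| := by linarith [abs_nonneg z.im]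
    have hF' : ‖D.toFun z‖ ≤ QQ * C₁ * (2 * ‖(κ : ℂ) + z‖) ^ A₁ := by
      refine hF.trans ?_
      have h1 : (1 + |z.im|) ^ A₁ ≤ (2 * ‖(κ : ℂ) + z‖) ^ A₁ := Real.rpow_le_rpow ht0 ht hA₁0
      have h2 : D.Q ^ (2 * κ - 1) * ((120 * Real.pi ^ 2) * β₀ ^ e₀) ^ n * (1 + |z.im|) ^ A₁ * Ab
          = D.Q ^ (2 * κ - 1) * C₁ * (1 + |z.im|) ^ A₁ := by rw [hC₁]; ring
      rw [h2]
      have hC₁' : 0 ≤ C₁ := hC₁0.le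
      calc D.Q ^ (2 * κ - 1) * C₁ * (1 + |z.im|) ^ A₁
          ≤ QQ * C₁ * (1 + |z.im|) ^ A₁ := by
            gcongr
      _ ≤ QQ * C₁ * (2 * ‖(κ : ℂ) + z‖) ^ A₁ :=
            mul_le_mul_of_nonneg_left h1 (by positivity)
    rw [hGF z hzne, norm_mul, norm_pow]
    calc ‖z - 1‖ ^ D.polarOrder * ‖D.toFun z‖
        ≤ ((κ + 2) * ‖(κ : ℂ) + z‖) ^ m₀ * (QQ * C₁ * (2 * ‖(κ : ℂ) + z‖) ^ A₁) :=
          mul_le_mul (hzpow z hz.ge) hF' (norm_nonneg _) (by positivity)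
      _ = (QQ * L) * (‖(κ : ℂ) + z‖ ^ (m₀ : ℝ) * ‖(κ : ℂ) + z‖ ^ A₁) := by
          rw [hL, mul_pow, Real.mul_rpow zero_le_two hQ0.le, Real.rpow_natCast]; ring
      _ = (QQ * L) * ‖(κ : ℂ) + z‖ ^ α := by
          rw [← Real.rpow_add hQ0, hα]
  -- (2) right edge
  have hright' : ∀ z : ℂ, z.re = κ → ‖G z‖ ≤ (QQ * R) * ‖(κ : ℂ) + z‖ ^ (m₀ : ℝ) := by
    intro z hz
    have hzne : z ≠ 1 := by
      intro h; rw [h, Complex.one_re] at hz; linarith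
    have hF : ‖D.toFun z‖ ≤ Ab := hAD z (by rw [hz]; linarith)
    have hQ1' := hQz z (by rw [hz]; linarith)
    have hQ0 : 0 < ‖(κ : ℂ) + z‖ := by linarith
    rw [hGF z hzne, norm_mul, norm_pow, Real.rpow_natCast]
    calc ‖z - 1‖ ^ D.polarOrder * ‖D.toFun z‖ ≤ ((κ + 2) * ‖(κ : ℂ) + z‖) ^ m₀ * Ab :=
          mul_le_mul (hzpow z (by rw [hz]; linarith)) hF (norm_nonneg _) (by positivity)
      _ = (1 * R) * ‖(κ : ℂ) + z‖ ^ m₀ := by rw [hR, mul_pow]; ring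
      _ ≤ (QQ * R) * ‖(κ : ℂ) + z‖ ^ m₀ := by
          gcongr
  -- (3) finite order inside the strip
  have hK : IsCompact (Icc (-κ) κ ×ℂ Icc (-(max κ ((2 : ℝ) ^ (max Bf 1)))) (max κ ((2 : ℝ) ^ (max Bf 1)))) :=
    isCompact_Icc.reProdIm isCompact_Icc
  obtain ⟨M₁, hM₁⟩ := hK.exists_bound_of_continuousOn hG.continuous.continuousOn
  have hgr : ∀ z : ℂ, 1 - κ < z.re → z.re < κ →
      ‖G z‖ ≤ (|M₁| + |Af| + 1) * Real.exp (|z.im| ^ (max Bf 1 + 1)) := by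
    intro z hza hzb
    have hre : |z.re| ≤ κ := abs_le.mpr ⟨by linarith, by linarith⟩
    have hexp1 : 1 ≤ Real.exp (|z.im| ^ (max Bf 1 + 1)) :=
      Real.one_le_exp (Real.rpow_nonneg (abs_nonneg _) _)
    rcases le_or_gt |z.im| (max κ ((2 : ℝ) ^ (max Bf 1))) with hsmall | hlarge
    · have hmem : z ∈ Icc (-κ) κ ×ℂ Icc (-(max κ ((2 : ℝ) ^ (max Bf 1)))) (max κ ((2 : ℝ) ^ (max Bf 1))) :=
        ⟨abs_le.mp hre, abs_le.mp hsmall⟩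
      calc ‖G z‖ ≤ M₁ := hM₁ z hmem
        _ ≤ (|M₁| + |Af| + 1) * 1 := by linarith [le_abs_self M₁, abs_nonneg Af]
        _ ≤ (|M₁| + |Af| + 1) * Real.exp (|z.im| ^ (max Bf 1 + 1)) :=
            mul_le_mul_of_nonneg_left hexp1 (by positivity)
    · have hzne : z ≠ 1 := by
        intro h; rw [h, Complex.one_im, abs_zero] at hlarge
        linarith [le_max_left κ ((2 : ℝ) ^ (max Bf 1))]
      have hpow := norm_rpow_le_abs_im_rpow (B := Bf) (by linarith) hre (le_max_left _ _)
        (le_max_right _ _) hlarge.le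
      calc ‖G z‖ = ‖(z - 1) ^ D.polarOrder * D.toFun z‖ := by rw [hGF z hzne]
        _ ≤ Af * Real.exp (‖z‖ ^ Bf) := hfin z hzne
        _ ≤ |Af| * Real.exp (‖z‖ ^ Bf) :=
            mul_le_mul_of_nonneg_right (le_abs_self Af) (Real.exp_pos _).le
        _ ≤ |Af| * Real.exp (|z.im| ^ (max Bf 1 + 1)) :=
            mul_le_mul_of_nonneg_left (Real.exp_le_exp.mpr hpow) (abs_nonneg Af)
        _ ≤ (|M₁| + |Af| + 1) * Real.exp (|z.im| ^ (max Bf 1 + 1)) := by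
            apply mul_le_mul_of_nonneg_right _ (Real.exp_pos _).le
            linarith [abs_nonneg M₁]
  -- Rademacher
  have hAℓ0 : 0 < QQ * L := mul_pos hQQ0 hL0
  have hBr0 : 0 < QQ * R := mul_pos hQQ0 hR0
  have hβα : (m₀ : ℝ) ≤ α := by rw [hα]; linarith
  have h := rademacher_phragmenLindelof_of_finiteOrder (f := G) (Q := κ) hab (by linarith) hAℓ0 hBr0
      hβα hG.diffContOnCl (by linarith [le_max_right Bf 1] : (0 : ℝ) < max Bf 1 + 1) hgr hleft' hright'
      (hσ₁.trans hs₁) (hs₂.trans hσ₂)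
  have hsa : 1 - κ ≤ s.re := hσ₁.trans hs₁
  have hQ1s := hQz s hsa
  have hQ0s : 0 < ‖(κ : ℂ) + s‖ := by linarith
  -- both factors are at most `QQ M'' ‖κ+s‖^α`
  have hθ0 : 0 ≤ (κ - s.re) / (κ - (1 - κ)) := div_nonneg (by linarith [hs₂.trans hσ₂]) (by linarith)
  have hθ1 : 0 ≤ (s.re - (1 - κ)) / (κ - (1 - κ)) := div_nonneg (by linarith) (by linarith)
  have hθsum : (κ - s.re) / (κ - (1 - κ)) + (s.re - (1 - κ)) / (κ - (1 - κ)) = 1 := by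
    rw [← add_div, div_eq_one_iff_eq (by linarith)]; ring
  have hMQ : 0 < QQ * M'' * ‖(κ : ℂ) + s‖ ^ α := by positivity
  have hX : QQ * L * ‖(κ : ℂ) + s‖ ^ α ≤ QQ * M'' * ‖(κ : ℂ) + s‖ ^ α := by
    have : L ≤ M'' := le_max_left _ _
    gcongr
  have hY : QQ * R * ‖(κ : ℂ) + s‖ ^ (m₀ : ℝ) ≤ QQ * M'' * ‖(κ : ℂ) + s‖ ^ α := by
    have h1 : R ≤ M'' := le_max_right _ _
    have h2 : ‖(κ : ℂ) + s‖ ^ (m₀ : ℝ) ≤ ‖(κ : ℂ) + s‖ ^ α :=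
      Real.rpow_le_rpow_of_exponent_le hQ1s hβα
    have h3 : QQ * R ≤ QQ * M'' := mul_le_mul_of_nonneg_left h1 hQQ0.le
    exact mul_le_mul h3 h2 (Real.rpow_nonneg hQ0s.le _) (by positivity)
  have hprod : (QQ * L * ‖(κ : ℂ) + s‖ ^ α) ^ ((κ - s.re) / (κ - (1 - κ))) *
      (QQ * R * ‖(κ : ℂ) + s‖ ^ (m₀ : ℝ)) ^ ((s.re - (1 - κ)) / (κ - (1 - κ)))
        ≤ QQ * M'' * ‖(κ : ℂ) + s‖ ^ α := by
    have h1 := Real.rpow_le_rpow (by positivity) hX hθ0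
    have h2 := Real.rpow_le_rpow (by positivity) hY hθ1
    refine (mul_le_mul h1 h2 (Real.rpow_nonneg (by positivity) _) (Real.rpow_nonneg hMQ.le _)).trans_eq ?_
    rw [← Real.rpow_add hMQ, hθsum, Real.rpow_one]
  -- `‖κ + s‖ ≤ 2κ (1 + |im s|)`
  have hQle : ‖(κ : ℂ) + s‖ ≤ 2 * κ * (1 + |s.im|) := by
    have hre : ((κ : ℂ) + s).re = κ + s.re := by simp
    have him : ((κ : ℂ) + s).im = s.im := by simp
    have hsb : s.re ≤ κ := hs₂.trans hσ₂
    calc ‖(κ : ℂ) + s‖ ≤ |((κ : ℂ) + s).re| + |((κ : ℂ) + s).im| := Complex.norm_le_abs_re_add_abs_im _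
      _ = |κ + s.re| + |s.im| := by rw [hre, him]
      _ ≤ 2 * κ + |s.im| := by rw [abs_of_nonneg (by linarith)]; linarith
      _ ≤ 2 * κ * (1 + |s.im|) := by nlinarith [abs_nonneg s.im]
  have ht1 : (1 : ℝ) ≤ 1 + |s.im| := by linarith [abs_nonneg s.im]
  -- `QQ ≤ max(1,Q)^Aexp`, `(1+|t|)^α ≤ (1+|t|)^Aexp`
  have hQQA : QQ ≤ max 1 D.Q ^ Aexp := Real.rpow_le_rpow_of_exponent_le hQ1 (le_max_right _ _)
  have htA : (1 + |s.im|) ^ α ≤ (1 + |s.im|) ^ Aexp :=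
    Real.rpow_le_rpow_of_exponent_le ht1 (le_max_left _ _)
  rw [← hGF s hs1]
  calc ‖G s‖ ≤ _ := h
    _ ≤ QQ * M'' * ‖(κ : ℂ) + s‖ ^ α := hprod
    _ ≤ QQ * M'' * (2 * κ * (1 + |s.im|)) ^ α :=
        mul_le_mul_of_nonneg_left (Real.rpow_le_rpow hQ0s.le hQle hα0) (by positivity)
    _ = M'' * (2 * κ) ^ α * QQ * (1 + |s.im|) ^ α := by
        rw [Real.mul_rpow (by linarith) (by linarith [abs_nonneg s.im])]; ring
    _ ≤ M'' * (2 * κ) ^ α * max 1 D.Q ^ Aexp * (1 + |s.im|) ^ Aexp := by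
        have h0 : 0 ≤ M'' * (2 * κ) ^ α := by positivity
        exact mul_le_mul (mul_le_mul_of_nonneg_left hQQA h0) htA (Real.rpow_nonneg (by linarith) _)
          (by positivity)

end SelbergDatum

end Literature.NumberTheory.LFunctions

end
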